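import Summits.BirchSwinnertonDyer.BirchSwinnertonDyer.Theorems.PrintCFramBottomClassIndexLawFiveLeEisensteinUpgradeOfModuleInvariants
import Summits.BirchSwinnertonDyer.BirchSwinnertonDyer.Theorems.UniversalToricDescentCharIdealVacuity
import HarnessLib

/-!
# Route `PrintCFram`, crux C2 `BottomClassIndexLawFiveLe` (stmt-BirchSwinnertonDyer-20372), line `eisenstein-resource-bdp-line`:
# ANATOMY OF THE REGISTERED MATCH STUB `stub_invariantMatch_cmRamified` (v2) — it is, frame by frame, the INEQUALITY
# «`μ_alg = 0 ∧ λ_alg ≤ λ_an`»; it is VACUOUS off the `Λ`-torsion locus of `X_(∅,0)`; at a frame where the ♭-BDP function is a unit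
# (`ord_p L_𝔭^{BDP}(f_W/K'')(𝟙) = 0`) it says exactly `Ch_Λ(X_(∅,0)(W/K''_∞)) = Λ`
# (cell `bsd-print-cfram`, width seat `bsd-line-cfram-p1-w2` g3; helper `--supports` 20372; THEOREMS ONLY, 0 facts, 0 definitions)

HONEST FRAMING. Nothing about BSD is proved; no stub is closed; the crux and the leaf stay OPEN. This file is a statement
anatomy of the v2 skeleton of record (`Cruxes/BottomClassIndexLawFiveLe/Lines/eisenstein_resource_bdp_line.lean`, ledger
sha16 d41b0569369063a3) for the planner (who is asked by LEAD g3 to promote the two research stubs to items) and for a β2 seat: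

* §1 norm currency of `𝓞_{ℂ_p}`: `‖x‖ < 1 ↔ x ∈ 𝔪`, `‖x‖ = 1 ↔ IsUnit x` (public versions of the private lemmas of p619535 /
  the EndState file).
* §2 `normMatch_iff_exists_order_le`: the stub's conclusion at a frame, «`∃ n, (∀ m < n, ‖Q_m‖ < 1) ∧ ∃ G ∈ I, ‖G_n‖ = 1`», is
  EQUIVALENT to «`∃ G ∈ I, Ḡ ≠ 0 ∧ ord Ḡ ≤ ord Q̄`» — `μ(I) = 0` and `λ(I) ≤ λ(Q)` (Literature
  `exists_isUnit_coeff_match_iff_exists_order_map_residue_le`). So stub 2 v2 = the Greenberg–Vatsal comparison as an INEQUALITY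
  (the other inequality `λ(Q) ≤ λ(I)` being stub 1's divisibility), not an equality of invariants.
* §3 by-name sockets on the crux binders: `stub_invariantMatch_cmRamified_of_lambdaLe` / `lambdaLe_of_stub_invariantMatch_cmRamified`
  (the registered signature verbatim ⟺ the `λ`-inequality form, all frames).
* §4 TORSION-LOCUS AUDIT (any curve over any number field, any `p`, any anticyclotomic datum): if `X = XAc E p κ 𝔭′ S γ` is NOT a
  torsion `Λ`-module then `Ch_Λ(X) = ⊤` (tree `charIdeal_eq_top_of_not_isTorsion`), so the MATCH holds for EVERY `Q`
  (`normMatch_map_charIdeal_of_not_isTorsion`) while the Eisenstein INCLUSION `Ch·𝓞_{ℂ_p}⟦T⟧ ⊆ (Q)` forces `Q` to be a UNIT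
  (`isUnit_of_charIdeal_map_le_span_of_not_isTorsion`); i.e. at every frame stub 1 says «`X_(∅,0)` is `Λ`-torsion ∨ `‖Q(0)‖ = 1`»
  BEFORE it says anything about divisibility, and stub 2 carries no torsion assertion at all.
* §5 UNIT-`Q` READING: `PowerSeries.map toCpInt : Λ → 𝓞_{ℂ_p}⟦T⟧` is a local homomorphism (`isLocalHom_map_toCpInt`), hence
  `I.map = ⊤ ↔ I = ⊤` (`map_toCpInt_eq_top_iff`); so at a frame where `Q` is a unit of `𝓞_{ℂ_p}⟦T⟧` (`‖Q(0)‖ = 1`, i.e. the BDP value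
  at the trivial character is a `p`-adic unit — for these additive curves `a_p = 0` and `Q(0) = u·(log_ω P)²`) the MATCH holds iff
  `Ch_Λ(X_(∅,0)) = Λ` (`normMatch_map_iff_eq_top_of_isUnit`), i.e. iff `X_(∅,0)` has no height-one support, while stub 1 is automatic
  there (`map_le_span_of_isUnit`).

Consequence for the promotion of β2′ (prose, not a statement change): the honest content of the registered MATCH is
«`μ(Ch_Λ X_(∅,0)) = 0` and `λ(Ch_Λ X_(∅,0)) ≤ λ(L_𝔭^{BDP})` at every ♭-BDP frame» — the module-side `μ = 0` (ideator v3 risk (b)/(c))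
is INSIDE the stub, the torsion-ness of `X_(∅,0)` is NOT (it rides with stub 1). BSD is not proved by any of this; no summit
statement is proved by this seat.

References: Greenberg–Vatsal, Invent. Math. 142 (2000) §1 (1)–(2), Thm. (1.3) [GreenbergVatsal2000]; Castella–Grossi–Lee–Skinner,
Invent. Math. 227 (2022) Thm. 3.2.1, proof of Thm. 5.1.1 [CastellaGrossiLeeSkinner2022]; Washington, GTM 83 §13.2 [Washington1997];
Castella, Camb. J. Math. 6 (2018) Thm. 2.3 [Castella2018].
-/

noncomputable section

open scoped Classical

set_option linter.dupNamespace false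
set_option autoImplicit false

namespace Summit.BirchSwinnertonDyer.BirchSwinnertonDyer.Theorems.PrintCFram.EisensteinMatchAnatomy

open WeierstrassCurve NumberField IsDedekindDomain Field PowerSeries IsLocalRing
  Literature.NumberTheory.EllipticCurves
  Literature.NumberTheory.EllipticCurves.ModularForms
  Literature.NumberTheory.EllipticCurves.Rank1Residual
  Literature.NumberTheory.EllipticCurves.Rank1Residual.Typed
  Literature.NumberTheory.GaloisRepresentations
  Literature.RingTheory.PowerSeries
  Summit.BirchSwinnertonDyer.Rank1Residual
  Summit.BirchSwinnertonDyer.Rank1Residual.X11b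
  Summit.BirchSwinnertonDyer.Rank1Residual.X11b.AcSelmer
  Summit.BirchSwinnertonDyer.BirchSwinnertonDyer.Theorems
  Summit.BirchSwinnertonDyer.BirchSwinnertonDyer.Theorems.SchneiderFree
  Summit.BirchSwinnertonDyer.BirchSwinnertonDyer.Theorems.PrintCFram.EisensteinResourceBdpLine
  Summit.BirchSwinnertonDyer.BirchSwinnertonDyer.Theorems.UniversalToricDescentCharIdealVacuity

/-! ## §1 Norm currency of `𝓞_{ℂ_p}`: non-units have norm `< 1`, units have norm `1` -/

section Norm

variable {p : ℕ} [Fact p.Prime]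

/-- A unit of `𝓞_{ℂ_p}` has norm `1` in `ℂ_p` (`‖u‖·‖u⁻¹‖ = 1` with both factors `≤ 1`). [folklore] -/
theorem norm_eq_one_of_isUnit {x : PadicComplexInt p} (hx : IsUnit x) : ‖(x : ℂ_[p])‖ = 1 := by
  obtain ⟨u, rfl⟩ := hx
  have h1 : ‖((u : PadicComplexInt p) : ℂ_[p])‖ *
      ‖(((u⁻¹ : (PadicComplexInt p)ˣ) : PadicComplexInt p) : ℂ_[p])‖ = 1 := by
    rw [← norm_mul, ← MulMemClass.coe_mul, Units.mul_inv, OneMemClass.coe_one, norm_one]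
  have ha := R1.norm_coe_padicComplexInt_le_one p (u : PadicComplexInt p)
  have hb := R1.norm_coe_padicComplexInt_le_one p ((u⁻¹ : (PadicComplexInt p)ˣ) : PadicComplexInt p)
  have h0 := norm_nonneg (((u : PadicComplexInt p)) : ℂ_[p])
  nlinarith

/-- **`‖x‖ = 1 ↔ x` is a unit of `𝓞_{ℂ_p}`** (the tree's `Dwork.isUnit_unitBall_of_norm_eq_one` and §1's converse). [folklore] -/
theorem norm_eq_one_iff_isUnit (x : PadicComplexInt p) : ‖(x : ℂ_[p])‖ = 1 ↔ IsUnit x :=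
  ⟨fun h => Literature.NumberTheory.LFunctions.Dwork.isUnit_unitBall_of_norm_eq_one h, norm_eq_one_of_isUnit⟩

/-- **`‖x‖ < 1 ↔ x ∈ 𝔪_{𝓞_{ℂ_p}}`** (every element has norm `≤ 1`; norm `1` is exactly the units). [folklore] -/
theorem norm_lt_one_iff_mem_maximalIdeal (x : PadicComplexInt p) :
    ‖(x : ℂ_[p])‖ < 1 ↔ x ∈ maximalIdeal (PadicComplexInt p) := by
  rw [mem_maximalIdeal, mem_nonunits_iff, ← norm_eq_one_iff_isUnit]
  constructor
  · exact fun h => ne_of_lt h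
  · exact fun h => lt_of_le_of_ne (R1.norm_coe_padicComplexInt_le_one p x) h

/-- A power series over `𝓞_{ℂ_p}` is a unit iff its constant coefficient has norm `1`. [folklore] -/
theorem isUnit_iff_norm_constantCoeff_eq_one (Q : PowerSeries (PadicComplexInt p)) :
    IsUnit Q ↔ ‖((PowerSeries.constantCoeff Q : PadicComplexInt p) : ℂ_[p])‖ = 1 := by
  rw [PowerSeries.isUnit_iff_constantCoeff, norm_eq_one_iff_isUnit]

end Norm

/-! ## §2 The MATCH in norm currency ⟺ the residual-order inequality «`μ(I) = 0 ∧ λ(I) ≤ λ(Q)`» -/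

section Match

variable {p : ℕ} [Fact p.Prime]

/-- The stub's norm-currency match ⟺ the unit-currency match of the Literature file. [folklore] -/
theorem normMatch_iff_unitMatch (I : Ideal (PowerSeries (PadicComplexInt p))) (Q : PowerSeries (PadicComplexInt p)) :
    (∃ n : ℕ, (∀ m < n, ‖((PowerSeries.coeff m Q : 𝓞_ℂ_[p]) : ℂ_[p])‖ < 1) ∧
        ∃ G ∈ I, ‖((PowerSeries.coeff n G : 𝓞_ℂ_[p]) : ℂ_[p])‖ = 1) ↔
      ∃ n : ℕ, (∀ m < n, PowerSeries.coeff m Q ∈ maximalIdeal (PadicComplexInt p)) ∧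
        ∃ G ∈ I, IsUnit (PowerSeries.coeff n G) := by
  simp only [norm_lt_one_iff_mem_maximalIdeal, norm_eq_one_iff_isUnit]

/-- **The registered MATCH at a frame ⟺ «`μ(I) = 0 ∧ λ(I) ≤ λ(Q)`»**: for an ideal `I` of `𝓞_{ℂ_p}⟦T⟧` (at a frame: the image
characteristic ideal `Ch_Λ(X_(∅,0))·𝓞_{ℂ_p}⟦T⟧`) and `Q` (the ♭-BDP function), the stub's conclusion
«`∃ n, (∀ m < n, ‖Q_m‖ < 1) ∧ ∃ G ∈ I, ‖G_n‖ = 1`» holds iff some `G ∈ I` has non-zero reduction `Ḡ ∈ 𝔽̄_p⟦T⟧` with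
`ord Ḡ ≤ ord Q̄`. [cite: GreenbergVatsal2000, §1 p. 18, (1)–(2) and Thm. (1.3)] -/
theorem normMatch_iff_exists_order_le (I : Ideal (PowerSeries (PadicComplexInt p))) (Q : PowerSeries (PadicComplexInt p)) :
    (∃ n : ℕ, (∀ m < n, ‖((PowerSeries.coeff m Q : 𝓞_ℂ_[p]) : ℂ_[p])‖ < 1) ∧
        ∃ G ∈ I, ‖((PowerSeries.coeff n G : 𝓞_ℂ_[p]) : ℂ_[p])‖ = 1) ↔
      ∃ G ∈ I, PowerSeries.map (residue (PadicComplexInt p)) G ≠ 0 ∧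
        (PowerSeries.map (residue (PadicComplexInt p)) G).order ≤
          (PowerSeries.map (residue (PadicComplexInt p)) Q).order := by
  rw [normMatch_iff_unitMatch, exists_isUnit_coeff_match_iff_exists_order_map_residue_le]

/-- **Inclusion + MATCH at a frame ⟹ EQUAL `λ` and `(Q) = (G)`**: if `I ≤ (Q)` (stub 1 at the frame) and the match holds
(stub 2 at the frame) then the matching `G ∈ I` has `ord Ḡ = ord Q̄` and `Q ∼ G`. [cite: CastellaGrossiLeeSkinner2022, proof of Thm. 5.1.1 (arXiv:2008.02571 p. 23)] -/
theorem exists_associated_of_incl_of_normMatch {I : Ideal (PowerSeries (PadicComplexInt p))}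
    {Q : PowerSeries (PadicComplexInt p)} (hI : I ≤ Ideal.span {Q})
    (h : ∃ n : ℕ, (∀ m < n, ‖((PowerSeries.coeff m Q : 𝓞_ℂ_[p]) : ℂ_[p])‖ < 1) ∧
        ∃ G ∈ I, ‖((PowerSeries.coeff n G : 𝓞_ℂ_[p]) : ℂ_[p])‖ = 1) :
    ∃ G ∈ I, PowerSeries.map (residue (PadicComplexInt p)) G ≠ 0 ∧
      (PowerSeries.map (residue (PadicComplexInt p)) Q).order =
        (PowerSeries.map (residue (PadicComplexInt p)) G).order ∧ Associated Q G :=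
  exists_associated_of_le_span_of_match hI ((normMatch_iff_unitMatch I Q).mp h)

end Match

/-! ## §3 By-name sockets: the registered stub 2 (v2) ⟺ the `λ`-inequality form, on the crux binders -/

section Sockets

/-- **Registered stub 2 of the v2 skeleton (`stub_invariantMatch_cmRamified`, signature VERBATIM as conclusion) ⟸ the
`λ`-INEQUALITY form** «at every ♭-BDP frame of a CM-ramified `W` (`p ≥ 5`, `r_an = 1`) over a Heegner field: some element of the
image characteristic ideal `Ch_Λ(X_(∅,0))·𝓞_{ℂ_p}⟦T⟧` has non-zero reduction of order `≤ ord Q̄`» (`μ_alg = 0 ∧ λ_alg ≤ λ_an`).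
CONDITIONAL on the displayed hypothesis (research: the Greenberg–Vatsal comparison at an additive split prime); closes nothing.
[cite: GreenbergVatsal2000, §1 p. 18, (1)–(2) and Thm. (1.3)] [cite: CastellaGrossiLeeSkinner2022, Thm. 3.2.1 (arXiv:2008.02571 p. 4)] -/
theorem stub_invariantMatch_cmRamified_of_lambdaLe
    (hlam : ∀ (p : ℕ) [Fact p.Prime] (W : WeierstrassCurve ℚ) [W.IsElliptic] [W.IsGloballyMinimal],
      W.HasCM → CMRamified W p → 5 ≤ p → W.analyticRank = 1 →
      ∀ (N : ℕ) [NeZero N] (K : Type) [Field K] [NumberField K] (Dt : ModularParametrizationData W N),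
      W.conductorNorm ℤ = N → IsImaginaryQuadratic K → SatisfiesHeegnerHypothesis N K →
      ∀ (κ : ZpExtension K p), κ.IsAnticyclotomic → ∀ (γ : Field.absoluteGaloisGroup K) [Fact (κ.IsTopGenerator γ)]
        (𝔭 : HeightOneSpectrum (𝓞 K)), ((p : ℕ) : 𝓞 K) ∈ 𝔭.asIdeal → 𝔭.asIdeal.ramificationIdx (𝓞 ℚ) = 1 →
        𝔭.asIdeal.inertiaDeg (𝓞 ℚ) = 1 → ∀ (𝔭' : HeightOneSpectrum (𝓞 K)), ((p : ℕ) : 𝓞 K) ∈ 𝔭'.asIdeal → 𝔭' ≠ 𝔭 →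
        ∀ (ι' : PadicAlgCl p ≃+* ℂ), SchneiderFree.BranchInducesPrime p ι' 𝔭 →
        ∀ (ΩK : ℂ) (Ωp : ℂ_[p]) (Q : PowerSeries (PadicComplexInt p)), ΩK ≠ 0 → Ωp ≠ 0 →
          R1.IsBDPLFunctionInt p ι' 𝔭 κ γ Dt.f ΩK Ωp Q →
          ∃ G ∈ (XAc.charIdeal (W.baseChange K) p κ 𝔭' ∅ γ).map (PowerSeries.map (R1.toCpInt p)),
            PowerSeries.map (residue (PadicComplexInt p)) G ≠ 0 ∧
              (PowerSeries.map (residue (PadicComplexInt p)) G).order ≤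
                (PowerSeries.map (residue (PadicComplexInt p)) Q).order) :
    ∀ (p : ℕ) [Fact p.Prime] (W : WeierstrassCurve ℚ) [W.IsElliptic] [W.IsGloballyMinimal],
      W.HasCM → CMRamified W p → 5 ≤ p → W.analyticRank = 1 →
      ∀ (N : ℕ) [NeZero N] (K : Type) [Field K] [NumberField K] (Dt : ModularParametrizationData W N),
      W.conductorNorm ℤ = N → IsImaginaryQuadratic K → SatisfiesHeegnerHypothesis N K →
      ∀ (κ : ZpExtension K p), κ.IsAnticyclotomic → ∀ (γ : Field.absoluteGaloisGroup K) [Fact (κ.IsTopGenerator γ)]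
        (𝔭 : HeightOneSpectrum (𝓞 K)), ((p : ℕ) : 𝓞 K) ∈ 𝔭.asIdeal → 𝔭.asIdeal.ramificationIdx (𝓞 ℚ) = 1 →
        𝔭.asIdeal.inertiaDeg (𝓞 ℚ) = 1 → ∀ (𝔭' : HeightOneSpectrum (𝓞 K)), ((p : ℕ) : 𝓞 K) ∈ 𝔭'.asIdeal → 𝔭' ≠ 𝔭 →
        ∀ (ι' : PadicAlgCl p ≃+* ℂ), SchneiderFree.BranchInducesPrime p ι' 𝔭 →
        ∀ (ΩK : ℂ) (Ωp : ℂ_[p]) (Q : PowerSeries (PadicComplexInt p)), ΩK ≠ 0 → Ωp ≠ 0 →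
          R1.IsBDPLFunctionInt p ι' 𝔭 κ γ Dt.f ΩK Ωp Q →
          ∃ n : ℕ, (∀ m < n, ‖((PowerSeries.coeff m Q : 𝓞_ℂ_[p]) : ℂ_[p])‖ < 1) ∧
            ∃ G ∈ (XAc.charIdeal (W.baseChange K) p κ 𝔭' ∅ γ).map (PowerSeries.map (R1.toCpInt p)),
              ‖((PowerSeries.coeff n G : 𝓞_ℂ_[p]) : ℂ_[p])‖ = 1 := by
  intro p _ W _ _ hCM hram h5 hr N _ K _ _ Dt hN hK hHN κ hκ γ _ 𝔭 h𝔭 he hf 𝔭' h𝔭' hne ι' hind ΩK Ωp Q hΩK hΩp hBDP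
  exact (normMatch_iff_exists_order_le _ Q).mpr
    (hlam p W hCM hram h5 hr N K Dt hN hK hHN κ hκ γ 𝔭 h𝔭 he hf 𝔭' h𝔭' hne ι' hind ΩK Ωp Q hΩK hΩp hBDP)

/-- **Conversely, the registered stub 2 (signature VERBATIM as hypothesis) ⟹ the `λ`-inequality form at every frame.**
Together with `stub_invariantMatch_cmRamified_of_lambdaLe`: the research content of stub 2 v2 is EXACTLY «`μ(Ch_Λ X_(∅,0)) = 0` and
`λ(Ch_Λ X_(∅,0)) ≤ λ(L_𝔭^{BDP})` (residual orders in `𝔽̄_p⟦T⟧`) at every ♭-BDP frame». CONDITIONAL; closes nothing.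
[cite: GreenbergVatsal2000, §1 p. 18, (1)–(2) and Thm. (1.3)] -/
theorem lambdaLe_of_stub_invariantMatch_cmRamified
    (hmatch : ∀ (p : ℕ) [Fact p.Prime] (W : WeierstrassCurve ℚ) [W.IsElliptic] [W.IsGloballyMinimal],
      W.HasCM → CMRamified W p → 5 ≤ p → W.analyticRank = 1 →
      ∀ (N : ℕ) [NeZero N] (K : Type) [Field K] [NumberField K] (Dt : ModularParametrizationData W N),
      W.conductorNorm ℤ = N → IsImaginaryQuadratic K → SatisfiesHeegnerHypothesis N K →
      ∀ (κ : ZpExtension K p), κ.IsAnticyclotomic → ∀ (γ : Field.absoluteGaloisGroup K) [Fact (κ.IsTopGenerator γ)]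
        (𝔭 : HeightOneSpectrum (𝓞 K)), ((p : ℕ) : 𝓞 K) ∈ 𝔭.asIdeal → 𝔭.asIdeal.ramificationIdx (𝓞 ℚ) = 1 →
        𝔭.asIdeal.inertiaDeg (𝓞 ℚ) = 1 → ∀ (𝔭' : HeightOneSpectrum (𝓞 K)), ((p : ℕ) : 𝓞 K) ∈ 𝔭'.asIdeal → 𝔭' ≠ 𝔭 →
        ∀ (ι' : PadicAlgCl p ≃+* ℂ), SchneiderFree.BranchInducesPrime p ι' 𝔭 →
        ∀ (ΩK : ℂ) (Ωp : ℂ_[p]) (Q : PowerSeries (PadicComplexInt p)), ΩK ≠ 0 → Ωp ≠ 0 →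
          R1.IsBDPLFunctionInt p ι' 𝔭 κ γ Dt.f ΩK Ωp Q →
          ∃ n : ℕ, (∀ m < n, ‖((PowerSeries.coeff m Q : 𝓞_ℂ_[p]) : ℂ_[p])‖ < 1) ∧
            ∃ G ∈ (XAc.charIdeal (W.baseChange K) p κ 𝔭' ∅ γ).map (PowerSeries.map (R1.toCpInt p)),
              ‖((PowerSeries.coeff n G : 𝓞_ℂ_[p]) : ℂ_[p])‖ = 1) :
    ∀ (p : ℕ) [Fact p.Prime] (W : WeierstrassCurve ℚ) [W.IsElliptic] [W.IsGloballyMinimal],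
      W.HasCM → CMRamified W p → 5 ≤ p → W.analyticRank = 1 →
      ∀ (N : ℕ) [NeZero N] (K : Type) [Field K] [NumberField K] (Dt : ModularParametrizationData W N),
      W.conductorNorm ℤ = N → IsImaginaryQuadratic K → SatisfiesHeegnerHypothesis N K →
      ∀ (κ : ZpExtension K p), κ.IsAnticyclotomic → ∀ (γ : Field.absoluteGaloisGroup K) [Fact (κ.IsTopGenerator γ)]
        (𝔭 : HeightOneSpectrum (𝓞 K)), ((p : ℕ) : 𝓞 K) ∈ 𝔭.asIdeal → 𝔭.asIdeal.ramificationIdx (𝓞 ℚ) = 1 →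
        𝔭.asIdeal.inertiaDeg (𝓞 ℚ) = 1 → ∀ (𝔭' : HeightOneSpectrum (𝓞 K)), ((p : ℕ) : 𝓞 K) ∈ 𝔭'.asIdeal → 𝔭' ≠ 𝔭 →
        ∀ (ι' : PadicAlgCl p ≃+* ℂ), SchneiderFree.BranchInducesPrime p ι' 𝔭 →
        ∀ (ΩK : ℂ) (Ωp : ℂ_[p]) (Q : PowerSeries (PadicComplexInt p)), ΩK ≠ 0 → Ωp ≠ 0 →
          R1.IsBDPLFunctionInt p ι' 𝔭 κ γ Dt.f ΩK Ωp Q →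
          ∃ G ∈ (XAc.charIdeal (W.baseChange K) p κ 𝔭' ∅ γ).map (PowerSeries.map (R1.toCpInt p)),
            PowerSeries.map (residue (PadicComplexInt p)) G ≠ 0 ∧
              (PowerSeries.map (residue (PadicComplexInt p)) G).order ≤
                (PowerSeries.map (residue (PadicComplexInt p)) Q).order := by
  intro p _ W _ _ hCM hram h5 hr N _ K _ _ Dt hN hK hHN κ hκ γ _ 𝔭 h𝔭 he hf 𝔭' h𝔭' hne ι' hind ΩK Ωp Q hΩK hΩp hBDP
  exact (normMatch_iff_exists_order_le _ Q).mp
    (hmatch p W hCM hram h5 hr N K Dt hN hK hHN κ hκ γ 𝔭 h𝔭 he hf 𝔭' h𝔭' hne ι' hind ΩK Ωp Q hΩK hΩp hBDP)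

end Sockets

/-! ## §4 Torsion-locus audit: off the `Λ`-torsion locus of `X` the MATCH is vacuous and the INCLUSION forces `Q` to be a unit -/

section TorsionLocus

variable {K : Type} [Field K] [NumberField K] (E : WeierstrassCurve K) (p : ℕ) [Fact p.Prime]
  (κ : ZpExtension K p) (𝔭' : HeightOneSpectrum (𝓞 K)) (S : Finset (HeightOneSpectrum (𝓞 K)))
  (γ : Field.absoluteGaloisGroup K) [Fact (κ.IsTopGenerator γ)]

/-- **Off the torsion locus the MATCH is vacuous.** If `X = XAc E p κ 𝔭′ S γ` is NOT a torsion `Λ`-module then `Ch_Λ(X) = ⊤`, its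
image in `𝓞_{ℂ_p}⟦T⟧` is `⊤`, and the norm-currency match holds for EVERY `Q` (`n = 0`, `G = 1`). So the registered stub 2 asserts
nothing at such a frame; in particular it does NOT assert that `X_(∅,0)` is `Λ`-torsion.
[cite: Washington1997, §13.2 (characteristic ideal of a torsion Λ-module; junk off torsion)] [cite: Castella2018, Thm. 2.3 (arXiv:1704.06608 p. 5) (the torsion hypothesis behind Ch_Λ(X_ac))] -/
theorem normMatch_map_charIdeal_of_not_isTorsion
    (h : ¬ Module.IsTorsion (IwasawaAlgebra p) (XAc E p κ 𝔭' S γ)) (Q : PowerSeries (PadicComplexInt p)) :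
    ∃ n : ℕ, (∀ m < n, ‖((PowerSeries.coeff m Q : 𝓞_ℂ_[p]) : ℂ_[p])‖ < 1) ∧
      ∃ G ∈ (XAc.charIdeal E p κ 𝔭' S γ).map (PowerSeries.map (R1.toCpInt p)),
        ‖((PowerSeries.coeff n G : 𝓞_ℂ_[p]) : ℂ_[p])‖ = 1 := by
  rw [normMatch_iff_unitMatch, show XAc.charIdeal E p κ 𝔭' S γ = ⊤ from xacCharIdeal_eq_top_of_not_isTorsion E p κ 𝔭' S γ h,
    Ideal.map_top]
  exact exists_isUnit_coeff_match_top Q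

/-- **Off the torsion locus the INCLUSION forces `Q` to be a unit.** If `X` is not `Λ`-torsion and the Eisenstein inclusion
`Ch_Λ(X)·𝓞_{ℂ_p}⟦T⟧ ⊆ (Q)` holds (stub 1 at the frame), then `⊤ ⊆ (Q)`, i.e. `Q` is a unit of `𝓞_{ℂ_p}⟦T⟧` (`‖Q(0)‖ = 1`).
[cite: Washington1997, §13.2 (characteristic ideal of a torsion Λ-module; junk off torsion)] -/
theorem isUnit_of_charIdeal_map_le_span_of_not_isTorsion
    (h : ¬ Module.IsTorsion (IwasawaAlgebra p) (XAc E p κ 𝔭' S γ)) {Q : PowerSeries (PadicComplexInt p)}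
    (hle : (XAc.charIdeal E p κ 𝔭' S γ).map (PowerSeries.map (R1.toCpInt p)) ≤ Ideal.span {Q}) : IsUnit Q := by
  rw [xacCharIdeal_eq_top_of_not_isTorsion E p κ 𝔭' S γ h, Ideal.map_top] at hle
  exact isUnit_of_dvd_one (Ideal.mem_span_singleton.mp (hle Submodule.mem_top))

/-- **Stub 1 at a frame, read BEFORE divisibility: `X_(∅,0)` is `Λ`-torsion OR the ♭-BDP function is a unit** (`‖Q(0)‖ = 1`).
[cite: Washington1997, §13.2 (characteristic ideal of a torsion Λ-module; junk off torsion)] -/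
theorem isTorsion_or_norm_constantCoeff_eq_one_of_charIdeal_map_le_span {Q : PowerSeries (PadicComplexInt p)}
    (hle : (XAc.charIdeal E p κ 𝔭' S γ).map (PowerSeries.map (R1.toCpInt p)) ≤ Ideal.span {Q}) :
    Module.IsTorsion (IwasawaAlgebra p) (XAc E p κ 𝔭' S γ) ∨
      ‖((PowerSeries.constantCoeff Q : PadicComplexInt p) : ℂ_[p])‖ = 1 := by
  by_cases h : Module.IsTorsion (IwasawaAlgebra p) (XAc E p κ 𝔭' S γ)
  · exact Or.inl h
  · exact Or.inr ((isUnit_iff_norm_constantCoeff_eq_one Q).mp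
      (isUnit_of_charIdeal_map_le_span_of_not_isTorsion E p κ 𝔭' S γ h hle))

end TorsionLocus

/-! ## §5 Unit-`Q` reading: `Λ → 𝓞_{ℂ_p}⟦T⟧` is a local homomorphism; at a unit frame the MATCH is `Ch_Λ(X) = Λ` -/

section UnitQ

variable {p : ℕ} [Fact p.Prime]

/-- **`PowerSeries.map toCpInt : Λ = ℤ_p⟦T⟧ → 𝓞_{ℂ_p}⟦T⟧` is a LOCAL homomorphism**: a power series over `ℤ_p` whose image is a
unit has unit constant coefficient in `𝓞_{ℂ_p}`, hence (the structure map detects the maximal ideals, `toCpInt_mem_maximalIdeal_iff`)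
unit constant coefficient in `ℤ_p`, hence is a unit. [folklore] -/
theorem isLocalHom_map_toCpInt : IsLocalHom (PowerSeries.map (R1.toCpInt p)) := by
  refine ⟨fun g hg => ?_⟩
  rw [PowerSeries.isUnit_iff_constantCoeff] at hg ⊢
  rw [← PowerSeries.coeff_zero_eq_constantCoeff_apply, PowerSeries.coeff_map,
    PowerSeries.coeff_zero_eq_constantCoeff_apply] at hg
  by_contra hnu
  have hmem : PowerSeries.constantCoeff g ∈ maximalIdeal ℤ_[p] := (mem_maximalIdeal _).mpr hnu
  have := (EisensteinResourceBdpLine.toCpInt_mem_maximalIdeal_iff (PowerSeries.constantCoeff g)).mpr hmem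
  exact (mem_maximalIdeal _).mp this hg

/-- **An ideal of `Λ` generates the unit ideal of `𝓞_{ℂ_p}⟦T⟧` iff it is the unit ideal** (local homomorphism: a proper ideal
maps into the maximal ideal). [folklore] -/
theorem map_toCpInt_eq_top_iff (I : Ideal (IwasawaAlgebra p)) :
    I.map (PowerSeries.map (R1.toCpInt p)) = ⊤ ↔ I = ⊤ := by
  constructor
  · intro h
    by_contra hI
    haveI := isLocalHom_map_toCpInt (p := p)
    have hle : I ≤ maximalIdeal (IwasawaAlgebra p) := le_maximalIdeal hI
    have hmap : I.map (PowerSeries.map (R1.toCpInt p)) ≤ maximalIdeal (PowerSeries (PadicComplexInt p)) :=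
      (Ideal.map_mono hle).trans
        (((local_hom_TFAE (PowerSeries.map (R1.toCpInt p))).out 0 2).mp this)
    rw [h] at hmap
    exact (maximalIdeal.isMaximal (PowerSeries (PadicComplexInt p))).ne_top (top_le_iff.mp hmap)
  · rintro rfl
    exact Ideal.map_top _

/-- **At a frame where `Q` is a UNIT the MATCH says exactly `I = ⊤`**: for an ideal `I` of `Λ` (at a frame: `Ch_Λ(X_(∅,0))`) and a
unit `Q` of `𝓞_{ℂ_p}⟦T⟧` (`‖Q(0)‖ = 1`: the ♭-BDP value at the trivial character is a `p`-adic unit), the norm-currency match against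
`I·𝓞_{ℂ_p}⟦T⟧` holds iff `I = ⊤` — for `I = Ch_Λ(X)` with `X` finitely generated torsion: iff `X` has no height-one support
(is pseudo-null, i.e. finite). [cite: GreenbergVatsal2000, §1 p. 18, (1)–(2) and Thm. (1.3)] [cite: Washington1997, §13.2] -/
theorem normMatch_map_iff_eq_top_of_isUnit (I : Ideal (IwasawaAlgebra p)) {Q : PowerSeries (PadicComplexInt p)}
    (hQ : IsUnit Q) :
    (∃ n : ℕ, (∀ m < n, ‖((PowerSeries.coeff m Q : 𝓞_ℂ_[p]) : ℂ_[p])‖ < 1) ∧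
        ∃ G ∈ I.map (PowerSeries.map (R1.toCpInt p)), ‖((PowerSeries.coeff n G : 𝓞_ℂ_[p]) : ℂ_[p])‖ = 1) ↔
      I = ⊤ := by
  rw [normMatch_iff_unitMatch, exists_isUnit_coeff_match_iff_eq_top_of_isUnit hQ, map_toCpInt_eq_top_iff]

/-- At a unit frame the INCLUSION (stub 1) is automatic: `I·𝓞_{ℂ_p}⟦T⟧ ≤ (Q) = ⊤`. [folklore] -/
theorem map_le_span_of_isUnit (I : Ideal (IwasawaAlgebra p)) {Q : PowerSeries (PadicComplexInt p)} (hQ : IsUnit Q) :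
    I.map (PowerSeries.map (R1.toCpInt p)) ≤ Ideal.span {Q} := by
  rw [Ideal.span_singleton_eq_top.mpr hQ]
  exact le_top

variable {K : Type} [Field K] [NumberField K] (E : WeierstrassCurve K) (p)
  (κ : ZpExtension K p) (𝔭' : HeightOneSpectrum (𝓞 K)) (S : Finset (HeightOneSpectrum (𝓞 K)))
  (γ : Field.absoluteGaloisGroup K) [Fact (κ.IsTopGenerator γ)]

/-- **The two research stubs at a UNIT ♭-BDP frame, on the real module.** If `‖Q(0)‖ = 1` then: the Eisenstein inclusion
`Ch_Λ(X)·𝓞_{ℂ_p}⟦T⟧ ⊆ (Q)` holds with no input, and the invariant MATCH holds iff `Ch_Λ(XAc E p κ 𝔭′ S γ) = ⊤`. (With the line's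
proved exact control this is the frame-level statement «`Sel` over `K''` has the predicted order `p^0`»; nothing of it is proved
here.) [cite: GreenbergVatsal2000, §1 p. 18, (1)–(2) and Thm. (1.3)] [cite: Castella2018, Thm. 2.3 (arXiv:1704.06608 p. 5)] -/
theorem stubs_at_unit_frame_iff {Q : PowerSeries (PadicComplexInt p)}
    (hQ : ‖((PowerSeries.constantCoeff Q : PadicComplexInt p) : ℂ_[p])‖ = 1) :
    ((XAc.charIdeal E p κ 𝔭' S γ).map (PowerSeries.map (R1.toCpInt p)) ≤ Ideal.span {Q}) ∧
      ((∃ n : ℕ, (∀ m < n, ‖((PowerSeries.coeff m Q : 𝓞_ℂ_[p]) : ℂ_[p])‖ < 1) ∧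
          ∃ G ∈ (XAc.charIdeal E p κ 𝔭' S γ).map (PowerSeries.map (R1.toCpInt p)),
            ‖((PowerSeries.coeff n G : 𝓞_ℂ_[p]) : ℂ_[p])‖ = 1) ↔
        XAc.charIdeal E p κ 𝔭' S γ = ⊤) := by
  have hu : IsUnit Q := (isUnit_iff_norm_constantCoeff_eq_one Q).mpr hQ
  exact ⟨map_le_span_of_isUnit _ hu, normMatch_map_iff_eq_top_of_isUnit _ hu⟩

end UnitQ

end Summit.BirchSwinnertonDyer.BirchSwinnertonDyer.Theorems.PrintCFram.EisensteinMatchAnatomy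

end
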